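import Summits.QuantumFields.BalabanUV.Beta.GAN24.DerivativeRateTransferSqueeze

/-!
# `BalabanUV.Beta.GAN24.DerivativeRateTransferLoewnerGramBounded` — binder row G-an2-4 ∕ (CONV-C), route R6 «VALUES, NOT DERIVATIVES», PART 94:
# THE k-UNIFORM SIZE OF THE EFFECTIVE FORMS IS NOT AN INPUT OF THE TOWER END — `hB` FOLLOWS FROM (CONS) ALONE
# (unit b2b-balaban-gan24-p3, gen 48; v1)

NOT IN PRINT; OUR PROOF (for the ROUTE; [folklore] finite-dimensional linear algebra — PART 18's letters `effForm_step_diag_le_cons`,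
`abs_apply_le_of_diag_le`, `dotProduct_effForm_eq_energy` BY NAME, one geometric sum).  HONEST FRAMING (cell contract, verbatim): «discharging
`BetaPertH` makes Bałaban's UV stability UNCONDITIONAL — a real constructive-QFT result; it is NOT the continuum limit and NOT the Clay problem.»
HONEST DEPENDENCY (verbatim): «continuum YM on T⁴ ⇐ BetaPertH ∧ nine spine estimates (0/9 proved); BetaPertH ⇐ (D1) ∧ (D4) ∧ CAP+tail; G-an2-4
gates asym, D1 and NE2/3/4.»

WHY THIS FILE.  Every robust tower END of the route — PART 18 §6 (`effForm_entry_step_rate_of_stabSlack_of_cons`), PART 20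
(`effForm_entry_step_rate_of_stabGram_of_cons`), PART 88 (`towerEnd_of_stabFamily_of_schedules`), PART 90 §3–§4 — carries the hypothesis
`hB : ∀ j a b, |𝒮_j(a,b)| ≤ B`, a k-UNIFORM bound on the unit-lattice effective forms `𝒮_j = effForm (H j) (Qc j)` along the tower; the input
ledger of record (`HOME/b2b-balaban-gan24-p3/gen47/R6-SCHEDULE-NOTE.md` §4) lists it as «`hB` ∕ S2 — UNTYPED for Bałaban's tower», i.e. as an
S2-class uniform-boundedness input.  IT IS NOT AN INDEPENDENT INPUT.  The consistency datum (CONS_{j,y})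
`⟨ℋ_je_y, (P_jᵀH_{j+1}P_j − H_j)ℋ_je_y⟩ ≤ cst·θ^j` ALONE (no (STAB) of any shape) bounds the DIAGONAL STEP from above
(PART 18 `effForm_step_diag_le_cons`: the prolongated coarse minimiser is an admissible trial field one level up), so
`𝒮_j(y,y) ≤ 𝒮_0(y,y) + cst·(1 + θ + ⋯ + θ^{j−1}) ≤ B₀ + cst∕(1−θ)` for `0 ≤ θ < 1`; and `𝒮_j` is positive semidefinite because `H_j` is
(`⟨v,𝒮_jv⟩ = ⟨ℋ_jv, H_jℋ_jv⟩ ≥ 0`), so its entries are bounded by its diagonal: **`|𝒮_j(a,b)| ≤ B₀ + cst∕(1−θ)` for all `j, a, b`**, where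
`B₀` bounds the LEVEL-0 diagonal only — a fixed finite datum of the coarsest problem, not a k-uniform estimate.  The row «`hB` ∕ S2» of the
END's ledger is thereby replaced by «`B₀` = the level-0 diagonal» (bookkeeping); the k-uniformity that S2 asserts is, in the END's currency, a
COROLLARY of (CONS) with a summable schedule.  What stays untyped is unchanged otherwise: (CONS) itself [R8°], the Gram∕weighted mass letter `N` ∕
`W₀` [(H2) + R9°], the (STAB) family's schedules.

WHAT THIS FILE PROVES (0 sorry, 0 `def`, nothing cited; an1's letters `kkt ∕ minOp ∕ effForm` over `ℝ`, fine forms only PSD, bordered matrices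
nonsingular):
* §1 `abs_effForm_apply_le_of_diag_le` (`𝒮_{yy} ≤ B` for all `y` ⟹ `|𝒮_{ab}| ≤ B`; `𝒮` is PSD by PART 29's `DerivativeRateTransferSqueeze.posSemidef_effForm`).
* §2 **`effForm_diag_le_of_cons_sum`**: (CONS_{j,y}) `≤ cst·θ^j`, `Qc (j+1)·P j = Qc j`, `𝒮_0(y,y) ≤ B₀` ⟹ `𝒮_j(y,y) ≤ B₀ + cst·Σ_{i<j}θ^i` (any
  `θ`); **`effForm_diag_le_of_cons`** ∕ **`abs_effForm_le_of_cons`**: with `0 ≤ cst`, `0 ≤ θ < 1`, `|𝒮_j(a,b)| ≤ B₀ + cst∕(1−θ)` — THE PRODUCED `hB`.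
* §3 the ENDs with `hB` discharged: **`effForm_entry_step_rate_of_stabSlack_of_cons'`** (PART 18 §6: constant `(1+cε)·cst + 2cε·(B₀ + cst∕(1−θ))`),
  **`effForm_entry_step_rate_of_stabGram_of_cons'`** and `leg_energy_step_rate_of_stabGram_of_cons'` (PART 20: constant
  `cst + 2cε·(B₀ + cst∕(1−θ)) + 2cδ·N`, resp. `cst + cε·(…) + cδ·N`).  PART 88's family END takes the same `hB` and is discharged by the same
  `abs_effForm_le_of_cons` (one `exact`; not restated here — PART 88 is this file's sibling, not its import).
WHAT IT DOES NOT DO: bound `N` (the `G`-mass of the unit-source minimisers — (H2)-class, level-dependent in general: PART 88's growth letter);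
produce (CONS) or (STAB) for any operator; touch S2 proper (Bałaban's uniform bounds on effective DENSITIES, a statement about functional
integrals, of which this is only the quadratic-form shadow).  SUPPLIER work on route C-R6° (rank 2, REDUCTION); no consumer of record; NEVER
«G-an2-4 closed»; NOT (CONV-C), NOT D1, NOT `BetaPertH`, NOT continuum, NOT Clay.  Records: `HOME/b2b-balaban-gan24-p3/WOODBURY-FIBRE.md` v14.8,
`HOME/b2b-balaban-gan24-p3/gen48/README.md`.
-/

noncomputable section

open Set Matrix Finset

namespace Summit.QuantumFields.BalabanUV.Beta.GAN24.DerivativeRateTransferLoewnerGramBounded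

open Literature.MathematicalPhysics.QuantumFieldTheory.Balaban1983to89.Beta.Composition (kkt)
open Literature.MathematicalPhysics.QuantumFieldTheory.Balaban1983to89.Beta.CompositionSingular (effForm minOp)
open Summit.QuantumFields.BalabanUV.Beta.GAN24.DerivativeRateTransferLoewnerKKT (abs_apply_le_of_diag_le effForm_step_diag_le_cons
  effForm_entry_step_rate_of_stabSlack_of_cons)
open Summit.QuantumFields.BalabanUV.Beta.GAN24.DerivativeRateTransferLoewnerGram (effForm_entry_step_rate_of_stabGram_of_cons
  leg_energy_step_rate_of_stabGram_of_cons)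
open Summit.QuantumFields.BalabanUV.Beta.GAN24.DerivativeRateTransferSqueeze (posSemidef_effForm)

/-! ## §1 The entries of the (PSD) effective form are bounded by its diagonal -/

section PSD

variable {c ν : Type*} [Fintype c] [Fintype ν] [DecidableEq c] [DecidableEq ν]
variable {H : Matrix ν ν ℝ} {Q : Matrix c ν ℝ}

/-- **A DIAGONAL BOUND OF THE EFFECTIVE FORM BOUNDS ALL ITS ENTRIES**: `𝒮_{yy} ≤ B` for all `y` ⟹ `|𝒮_{ab}| ≤ B` (PSD `2 × 2` minors).
[folklore] -/
theorem abs_effForm_apply_le_of_diag_le (hH : H.PosSemidef) (h : IsUnit (kkt H Q).det) {B : ℝ}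
    (hdiag : ∀ y, effForm H Q y y ≤ B) (a b : c) : |effForm H Q a b| ≤ B :=
  abs_apply_le_of_diag_le (posSemidef_effForm hH h) hdiag a b

/-- the diagonal of the effective form is non-negative. [folklore] -/
theorem effForm_diag_nonneg (hH : H.PosSemidef) (h : IsUnit (kkt H Q).det) (y : c) : 0 ≤ effForm H Q y y :=
  (posSemidef_effForm hH h).diag_nonneg

end PSD

/-! ## §2 Along the tower: (CONS) alone bounds the diagonal, hence every entry, k-uniformly -/

section Tower

variable {c : Type*} [Fintype c] [DecidableEq c]
variable {ι : ℕ → Type*} [∀ j, Fintype (ι j)] [∀ j, DecidableEq (ι j)]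
variable {H : ∀ j, Matrix (ι j) (ι j) ℝ} {Qc : ∀ j, Matrix c (ι j) ℝ} {P : ∀ j, Matrix (ι (j + 1)) (ι j) ℝ} {cst θ B₀ : ℝ}

/-- **`effForm_diag_le_of_cons_sum` — (CONS) ALONE BOUNDS THE DIAGONAL ALONG THE TOWER** [our proof]: PSD fine forms, nonsingular bordered
matrices, `Qc (j+1)·P j = Qc j`, (CONS_{j,y}) `⟨ℋ_je_y, (P_jᵀH_{j+1}P_j − H_j)ℋ_je_y⟩ ≤ cst·θ^j` and a LEVEL-0 diagonal bound `𝒮_0(y,y) ≤ B₀`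
⟹ `𝒮_j(y,y) ≤ B₀ + cst·Σ_{i<j} θ^i` for all `j, y` — for ANY `θ` (no sign, no size condition); no (STAB) is used. -/
theorem effForm_diag_le_of_cons_sum (hH : ∀ j, (H j).PosSemidef) (hk : ∀ j, IsUnit (kkt (H j) (Qc j)).det)
    (hPQ : ∀ j, Qc (j + 1) * P j = Qc j)
    (hcons : ∀ j (y : c), (minOp (H j) (Qc j) *ᵥ Pi.single y 1) ⬝ᵥ
        (((P j)ᵀ * H (j + 1) * P j - H j) *ᵥ (minOp (H j) (Qc j) *ᵥ Pi.single y 1)) ≤ cst * θ ^ j)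
    (hB₀ : ∀ y, effForm (H 0) (Qc 0) y y ≤ B₀) :
    ∀ j (y : c), effForm (H j) (Qc j) y y ≤ B₀ + cst * ∑ i ∈ range j, θ ^ i := by
  intro j
  induction j with
  | zero => intro y; simpa only [range_zero, sum_empty, mul_zero, add_zero] using hB₀ y
  | succ j ih =>
    intro y
    have hstep := (effForm_step_diag_le_cons (hH (j + 1)) (hk j) (hk (j + 1)) (hPQ j) y).trans (hcons j y)
    have hy := ih y
    rw [sum_range_succ, mul_add]
    linarith

/-- the finite geometric sums of a ratio in `[0,1)` are bounded by `1∕(1−θ)`. [folklore] -/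
theorem sum_range_pow_le_inv_one_sub (hθ0 : 0 ≤ θ) (hθ1 : θ < 1) (j : ℕ) : ∑ i ∈ range j, θ ^ i ≤ 1 / (1 - θ) := by
  have h := mul_neg_geom_sum θ j
  rw [le_div_iff₀ (sub_pos.mpr hθ1), mul_comm, h]
  linarith [pow_nonneg hθ0 j]

/-- **`effForm_diag_le_of_cons` — THE k-UNIFORM DIAGONAL BOUND** [our proof]: as above with `0 ≤ cst`, `0 ≤ θ < 1` ⟹
`𝒮_j(y,y) ≤ B₀ + cst∕(1−θ)` for all `j, y`. -/
theorem effForm_diag_le_of_cons (hH : ∀ j, (H j).PosSemidef) (hk : ∀ j, IsUnit (kkt (H j) (Qc j)).det)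
    (hPQ : ∀ j, Qc (j + 1) * P j = Qc j) (hcst : 0 ≤ cst) (hθ0 : 0 ≤ θ) (hθ1 : θ < 1)
    (hcons : ∀ j (y : c), (minOp (H j) (Qc j) *ᵥ Pi.single y 1) ⬝ᵥ
        (((P j)ᵀ * H (j + 1) * P j - H j) *ᵥ (minOp (H j) (Qc j) *ᵥ Pi.single y 1)) ≤ cst * θ ^ j)
    (hB₀ : ∀ y, effForm (H 0) (Qc 0) y y ≤ B₀) :
    ∀ j (y : c), effForm (H j) (Qc j) y y ≤ B₀ + cst / (1 - θ) := by
  intro j y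
  have h := effForm_diag_le_of_cons_sum hH hk hPQ hcons hB₀ j y
  have hs := mul_le_mul_of_nonneg_left (sum_range_pow_le_inv_one_sub hθ0 hθ1 j) hcst
  rw [mul_one_div] at hs
  linarith

/-- **`abs_effForm_le_of_cons` — THE PRODUCED `hB`** [our proof]: PSD fine forms, nonsingular bordered matrices, `Qc (j+1)·P j = Qc j`,
(CONS_{j,y}) `≤ cst·θ^j` (`0 ≤ cst`, `0 ≤ θ < 1`), level-0 diagonal `𝒮_0(y,y) ≤ B₀` ⟹ **`|𝒮_j(a,b)| ≤ B₀ + cst∕(1−θ)` for all `j, a, b`** — the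
k-uniform entry bound every robust END of the route takes as `hB`, from the consistency datum alone. -/
theorem abs_effForm_le_of_cons (hH : ∀ j, (H j).PosSemidef) (hk : ∀ j, IsUnit (kkt (H j) (Qc j)).det)
    (hPQ : ∀ j, Qc (j + 1) * P j = Qc j) (hcst : 0 ≤ cst) (hθ0 : 0 ≤ θ) (hθ1 : θ < 1)
    (hcons : ∀ j (y : c), (minOp (H j) (Qc j) *ᵥ Pi.single y 1) ⬝ᵥ
        (((P j)ᵀ * H (j + 1) * P j - H j) *ᵥ (minOp (H j) (Qc j) *ᵥ Pi.single y 1)) ≤ cst * θ ^ j)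
    (hB₀ : ∀ y, effForm (H 0) (Qc 0) y y ≤ B₀) :
    ∀ j (a b : c), |effForm (H j) (Qc j) a b| ≤ B₀ + cst / (1 - θ) := fun j a b =>
  abs_effForm_apply_le_of_diag_le (hH j) (hk j) (effForm_diag_le_of_cons hH hk hPQ hcst hθ0 hθ1 hcons hB₀ j) a b

/-- the produced bound is non-negative (it bounds `𝒮_0(y,y) ≥ 0` whenever `c` is inhabited; in general from `0 ≤ B₀`). [folklore] -/
theorem boundB_nonneg (hB₀0 : 0 ≤ B₀) (hcst : 0 ≤ cst) (hθ1 : θ < 1) : 0 ≤ B₀ + cst / (1 - θ) :=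
  add_nonneg hB₀0 (div_nonneg hcst (sub_pos.mpr hθ1).le)

end Tower

/-! ## §3 The robust ENDs with `hB` discharged -/

section Ends

variable {c : Type*} [Fintype c] [DecidableEq c]
variable {ι : ℕ → Type*} [∀ j, Fintype (ι j)] [∀ j, DecidableEq (ι j)]
variable {H : ∀ j, Matrix (ι j) (ι j) ℝ} {Qf : ∀ j, Matrix (ι j) (ι (j + 1)) ℝ} {Qc : ∀ j, Matrix c (ι j) ℝ}
variable {P : ∀ j, Matrix (ι (j + 1)) (ι j) ℝ} {G : ∀ j, Matrix (ι j) (ι j) ℝ} {cst cε cδ θ B₀ N : ℝ}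

/-- **`effForm_entry_step_rate_of_stabSlack_of_cons'` — PART 18 §6's ROBUST END WITHOUT `hB`** [our proof]: (STAB-ε_j)
`(Qf j)ᵀ H_j (Qf j) ≤ (1 + cε·θ^j)·H_{j+1}`, (CONS_{j,y}) `≤ cst·θ^j`, level-0 diagonal `𝒮_0(y,y) ≤ B₀` (`0 ≤ cε, cst`, `0 ≤ θ < 1`) ⟹
`|𝒮_{j+1}(a,b) − 𝒮_j(a,b)| ≤ ((1 + cε)·cst + 2cε·(B₀ + cst∕(1−θ)))·θ^j`. -/
theorem effForm_entry_step_rate_of_stabSlack_of_cons' (hH : ∀ j, (H j).PosSemidef) (hk : ∀ j, IsUnit (kkt (H j) (Qc j)).det)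
    (hcomp : ∀ j, Qc (j + 1) = Qc j * Qf j) (hPQ : ∀ j, Qc (j + 1) * P j = Qc j) (hcε : 0 ≤ cε) (hcst : 0 ≤ cst)
    (hθ0 : 0 ≤ θ) (hθ1 : θ < 1)
    (hstab : ∀ j, ((1 + cε * θ ^ j) • H (j + 1) - (Qf j)ᵀ * H j * Qf j).PosSemidef)
    (hcons : ∀ j (y : c), (minOp (H j) (Qc j) *ᵥ Pi.single y 1) ⬝ᵥ
        (((P j)ᵀ * H (j + 1) * P j - H j) *ᵥ (minOp (H j) (Qc j) *ᵥ Pi.single y 1)) ≤ cst * θ ^ j)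
    (hB₀ : ∀ y, effForm (H 0) (Qc 0) y y ≤ B₀) :
    ∀ j (a b : c), |effForm (H (j + 1)) (Qc (j + 1)) a b - effForm (H j) (Qc j) a b| ≤
      ((1 + cε) * cst + 2 * cε * (B₀ + cst / (1 - θ))) * θ ^ j :=
  effForm_entry_step_rate_of_stabSlack_of_cons hH hk hcomp hPQ hcε hcst hθ0 hθ1.le hstab hcons
    (abs_effForm_le_of_cons hH hk hPQ hcst hθ0 hθ1 hcons hB₀)

/-- **`effForm_entry_step_rate_of_stabGram_of_cons'` — PART 20's TOWER END WITHOUT `hB`** [our proof]: PSD fine forms, nonsingular bordered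
matrices, `Qc (j+1) = Qc j·Qf j`, `Qc (j+1)·P j = Qc j`, symmetric `G j`; (STAB-ε_j,δ_j) `(Qf j)ᵀH_j(Qf j) ≤ (1 + cε·θ^j)·H_{j+1} + (cδ·θ^j)·G_{j+1}`,
(CONS_{j,y}) `≤ cst·θ^j`, `|(ℋ_jᵀG_jℋ_j)_{ab}| ≤ N`, level-0 diagonal `𝒮_0(y,y) ≤ B₀` (`0 ≤ cε, cδ, cst`, `0 ≤ θ < 1`) ⟹
`|𝒮_{j+1}(a,b) − 𝒮_j(a,b)| ≤ (cst + 2cε·(B₀ + cst∕(1−θ)) + 2cδ·N)·θ^j` for all `j, a, b`. -/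
theorem effForm_entry_step_rate_of_stabGram_of_cons' (hH : ∀ j, (H j).PosSemidef) (hk : ∀ j, IsUnit (kkt (H j) (Qc j)).det)
    (hcomp : ∀ j, Qc (j + 1) = Qc j * Qf j) (hPQ : ∀ j, Qc (j + 1) * P j = Qc j) (hG : ∀ j, (G j)ᵀ = G j)
    (hcε : 0 ≤ cε) (hcδ : 0 ≤ cδ) (hcst : 0 ≤ cst) (hθ0 : 0 ≤ θ) (hθ1 : θ < 1)
    (hstab : ∀ j, ((1 + cε * θ ^ j) • H (j + 1) + (cδ * θ ^ j) • G (j + 1) - (Qf j)ᵀ * H j * Qf j).PosSemidef)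
    (hcons : ∀ j (y : c), (minOp (H j) (Qc j) *ᵥ Pi.single y 1) ⬝ᵥ
        (((P j)ᵀ * H (j + 1) * P j - H j) *ᵥ (minOp (H j) (Qc j) *ᵥ Pi.single y 1)) ≤ cst * θ ^ j)
    (hB₀ : ∀ y, effForm (H 0) (Qc 0) y y ≤ B₀)
    (hN : ∀ j a b, |((minOp (H j) (Qc j))ᵀ * G j * minOp (H j) (Qc j)) a b| ≤ N) :
    ∀ j (a b : c), |effForm (H (j + 1)) (Qc (j + 1)) a b - effForm (H j) (Qc j) a b| ≤
      (cst + 2 * cε * (B₀ + cst / (1 - θ)) + 2 * cδ * N) * θ ^ j :=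
  effForm_entry_step_rate_of_stabGram_of_cons hH hk hcomp hPQ hG hcε hcδ hθ0 hstab hcons
    (abs_effForm_le_of_cons hH hk hPQ hcst hθ0 hθ1 hcons hB₀) hN

/-- **`leg_energy_step_rate_of_stabGram_of_cons'` — PART 20's LEGS WITHOUT `hB`** [our proof]: under the same hypotheses
`⟨P_jℋ_je_y − ℋ_{j+1}e_y, H_{j+1}(P_jℋ_je_y − ℋ_{j+1}e_y)⟩ ≤ (cst + cε·(B₀ + cst∕(1−θ)) + cδ·N)·θ^j` for all `j, y`. -/
theorem leg_energy_step_rate_of_stabGram_of_cons' (hH : ∀ j, (H j).PosSemidef) (hk : ∀ j, IsUnit (kkt (H j) (Qc j)).det)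
    (hcomp : ∀ j, Qc (j + 1) = Qc j * Qf j) (hPQ : ∀ j, Qc (j + 1) * P j = Qc j) (hG : ∀ j, (G j)ᵀ = G j)
    (hcε : 0 ≤ cε) (hcδ : 0 ≤ cδ) (hcst : 0 ≤ cst) (hθ0 : 0 ≤ θ) (hθ1 : θ < 1)
    (hstab : ∀ j, ((1 + cε * θ ^ j) • H (j + 1) + (cδ * θ ^ j) • G (j + 1) - (Qf j)ᵀ * H j * Qf j).PosSemidef)
    (hcons : ∀ j (y : c), (minOp (H j) (Qc j) *ᵥ Pi.single y 1) ⬝ᵥ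
        (((P j)ᵀ * H (j + 1) * P j - H j) *ᵥ (minOp (H j) (Qc j) *ᵥ Pi.single y 1)) ≤ cst * θ ^ j)
    (hB₀ : ∀ y, effForm (H 0) (Qc 0) y y ≤ B₀)
    (hN : ∀ j a b, |((minOp (H j) (Qc j))ᵀ * G j * minOp (H j) (Qc j)) a b| ≤ N) :
    ∀ j (y : c), (P j *ᵥ (minOp (H j) (Qc j) *ᵥ Pi.single y 1) - minOp (H (j + 1)) (Qc (j + 1)) *ᵥ Pi.single y 1) ⬝ᵥ
        (H (j + 1) *ᵥ (P j *ᵥ (minOp (H j) (Qc j) *ᵥ Pi.single y 1) - minOp (H (j + 1)) (Qc (j + 1)) *ᵥ Pi.single y 1)) ≤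
      (cst + cε * (B₀ + cst / (1 - θ)) + cδ * N) * θ ^ j :=
  leg_energy_step_rate_of_stabGram_of_cons hH hk hcomp hPQ hG hcε hcδ hθ0 hstab hcons
    (abs_effForm_le_of_cons hH hk hPQ hcst hθ0 hθ1 hcons hB₀) hN

/-- **`effForm_total_variation_le_of_cons` — THE SUMMED FORM** [our proof]: under (CONS) alone (as in `effForm_diag_le_of_cons`) the diagonal
increments that (CONS) controls are summable with the same tail: `𝒮_{j+n}(y,y) − 𝒮_j(y,y) ≤ cst·θ^j∕(1−θ)` for all `j, n, y` — the one-sided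
Cauchy estimate of the diagonal (the other side is (STAB)'s business: under exact (STAB) the increments are `≥ 0` and this is the Cauchy property). -/
theorem effForm_diag_sub_le_of_cons (hH : ∀ j, (H j).PosSemidef) (hk : ∀ j, IsUnit (kkt (H j) (Qc j)).det)
    (hPQ : ∀ j, Qc (j + 1) * P j = Qc j) (hcst : 0 ≤ cst) (hθ0 : 0 ≤ θ) (hθ1 : θ < 1)
    (hcons : ∀ j (y : c), (minOp (H j) (Qc j) *ᵥ Pi.single y 1) ⬝ᵥ
        (((P j)ᵀ * H (j + 1) * P j - H j) *ᵥ (minOp (H j) (Qc j) *ᵥ Pi.single y 1)) ≤ cst * θ ^ j) :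
    ∀ j n (y : c), effForm (H (j + n)) (Qc (j + n)) y y - effForm (H j) (Qc j) y y ≤ cst * θ ^ j / (1 - θ) := by
  intro j n y
  -- re-base the tower at level `j` and apply the summed diagonal bound with `B₀ := 𝒮_j(y,y)` … done directly by induction on `n`
  have key : ∀ n, effForm (H (j + n)) (Qc (j + n)) y y ≤ effForm (H j) (Qc j) y y + cst * θ ^ j * ∑ i ∈ range n, θ ^ i := by
    intro n
    induction n with
    | zero => simp only [Nat.add_zero, range_zero, sum_empty, mul_zero, add_zero, le_refl]
    | succ n ih =>
      have hstep := (effForm_step_diag_le_cons (hH (j + n + 1)) (hk (j + n)) (hk (j + n + 1)) (hPQ (j + n)) y).trans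
        (hcons (j + n) y)
      rw [sum_range_succ, mul_add, ← add_assoc]
      have : cst * θ ^ (j + n) = cst * θ ^ j * θ ^ n := by rw [pow_add, mul_assoc]
      linarith
  have hs := mul_le_mul_of_nonneg_left (sum_range_pow_le_inv_one_sub hθ0 hθ1 n) (mul_nonneg hcst (pow_nonneg hθ0 j))
  rw [mul_one_div] at hs
  linarith [key n]

end Ends

end Summit.QuantumFields.BalabanUV.Beta.GAN24.DerivativeRateTransferLoewnerGramBounded

end
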